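import Literature.NumberTheory.EllipticCurves.PAdicLFunctionTameMinusProofs
import Literature.NumberTheory.EllipticCurves.PAdicLFunctionTameBirchMeasureProofs
import HarnessLib

/-!
# Birch's lemma at the level of the measures, ODD twisting relation: `[x]⁺_g = c · Σ_b χ(b) [x + b/m]⁻_f` makes
# `μ_{g, χ(p)α}` the `χ`-weighted MINUS tame measure of `f` (PROOFS ONLY)

`Proofs` companion (theorems only; no definition, no named fact) of `PAdicLFunctionTameMinus` and the minus twin of
`PAdicLFunctionTameBirchMeasureProofs` (`msdMeasure_twist_eq_sum_msdMeasureTame`, Mazur–Tate–Teitelbaum §I.8–§I.10, Matsuno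
2000 §2 p. 84). For an ODD primitive quadratic `ψ` of conductor `m` the twisted newform `g = f ⊗ ψ` has its PLUS symbols on
the MINUS symbols of `f` (`exists_rat_forall_ratPlusSymbol_charTwist_eq_of_odd`: `[x]⁺_g = c · Σ_u ψ(u)[x + u/m]⁻_f`); the
Chinese-remainder algebra of the plus file goes through unchanged with `[·]⁻_f = ratMinusSymbol f` (periodicity
`ratMinusSymbol_add_intCast`):

* `sum_mul_ratMinusSymbol_tameFraction_eq`, `sum_mul_ratMinusSymbol_prime_mul_tameFraction_eq` — the `χ`-weighted sums of
  `[c/(pⁿm)]⁻_f` and `[p·c/(pⁿm)]⁻_f` over `b` are `χ(pⁿ)`, resp. `χ(p)χ(pⁿ)`, times the minus Birch sums at `x = a/pⁿ`, `p·a/pⁿ`;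
* **`msdMeasure_twist_eq_sum_msdMeasureTameMinus`** — `μ_{g, χ(p)α}(a + pⁿℤ_p) = c · Σ_{b mod m} χ(b) · μ⁻_{f,α,m}((a·m + pⁿℤ_p) × {b})`.

References: B. Mazur, J. Tate, J. Teitelbaum, Invent. Math. 84 (1986), §I.8–§I.10 [MazurTateTeitelbaum1986Invent]; K. Matsuno,
J. Number Theory 84 (2000), §2 (p. 84) [Matsuno2000].
-/

noncomputable section

open scoped MatrixGroups ModularForm

open CongruenceSubgroup Literature.NumberTheory.EllipticCurves.ModularForms

namespace Literature.NumberTheory.EllipticCurves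

section Birch

variable {N N' : ℕ} [NeZero N] [NeZero N'] (f : CuspForm (Gamma0 N) 2) (g : CuspForm (Gamma0 N') 2)
  {p : ℕ} [Fact p.Prime] {m : ℕ} [NeZero m]

/-- Reindexing a sum over `ℤ/m` by multiplication with a unit; private helper. [folklore] -/
private theorem sum_mul_unit_eq_minus {R : Type*} [AddCommMonoid R] (u : (ZMod m)ˣ) (G : ZMod m → R) :
    ∑ b : ZMod m, G (b * (u : ZMod m)) = ∑ b : ZMod m, G b :=
  Fintype.sum_bijective (· * (u : ZMod m)) (Units.mulRight_bijective u) _ _ fun _ ↦ rfl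

omit [NeZero N] [NeZero N'] in
/-- **The `χ`-weighted sum of `[c/(pⁿm)]⁻_f` over `b mod m` is `χ(pⁿ)` times the minus Birch sum at `x = a/pⁿ`**:
`Σ_b χ(b)[tameFraction(n, a m, b)]⁻_f = χ(pⁿ) Σ_b χ(b)[a/pⁿ + b/m]⁻_f` (reindex `b ↦ b pⁿ`, `tameFraction_mul_eq`); minus twin of
`sum_mul_ratPlusSymbol_tameFraction_eq`.
[cite: MazurTateTeitelbaum1986Invent, §I.8–I.10 (pp. 10–13)] -/
theorem sum_mul_ratMinusSymbol_tameFraction_eq (hmp : m.Coprime p) (χ : MulChar (ZMod m) ℚ) (n : ℕ)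
    (a : ZMod (p ^ n)) :
    ∑ b : ZMod m, χ b * ratMinusSymbol f (tameFraction p m n (a * (m : ZMod (p ^ n))) b) =
      χ ((p : ZMod m) ^ n) * ∑ b : ZMod m, χ b * ratMinusSymbol f ((a.val : ℚ) / (p : ℚ) ^ n + (b.val : ℚ) / m) := by
  have hcop : (p ^ n).Coprime m := (hmp.symm).pow_left n
  set u : (ZMod m)ˣ := ZMod.unitOfCoprime (p ^ n) hcop with hu
  have huval : (u : ZMod m) = (p : ZMod m) ^ n := by rw [hu, ZMod.coe_unitOfCoprime, Nat.cast_pow]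
  rw [← sum_mul_unit_eq_minus u, Finset.mul_sum]
  refine Finset.sum_congr rfl fun b _ ↦ ?_
  rw [huval, tameFraction_mul_eq hmp n a b, map_mul]
  ring

omit [NeZero N'] in
/-- **The `χ`-weighted sum of `[p · c/(pⁿm)]⁻_f` over `b mod m`**: `χ(p) Σ_b χ(b)[p · tameFraction(n, a m, b)]⁻_f =
χ(pⁿ) Σ_b χ(b)[p a/pⁿ + b/m]⁻_f` (reindex `b ↦ b pⁿ`, then `b ↦ p b`, `[r + k]⁻ = [r]⁻` for the carry
`(p · b.val − (p b).val)/m ∈ ℤ`); minus twin of `sum_mul_ratPlusSymbol_prime_mul_tameFraction_eq`. [cite: MazurTateTeitelbaum1986Invent, §I.8–I.10 (pp. 10–13)] -/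
theorem sum_mul_ratMinusSymbol_prime_mul_tameFraction_eq (hmp : m.Coprime p) (χ : MulChar (ZMod m) ℚ) (n : ℕ)
    (a : ZMod (p ^ n)) :
    χ (p : ZMod m) * ∑ b : ZMod m, χ b * ratMinusSymbol f ((p : ℚ) * tameFraction p m n (a * (m : ZMod (p ^ n))) b) =
      χ ((p : ZMod m) ^ n) *
        ∑ b : ZMod m, χ b * ratMinusSymbol f ((p : ℚ) * ((a.val : ℚ) / (p : ℚ) ^ n) + (b.val : ℚ) / m) := by
  have hcop : (p ^ n).Coprime m := (hmp.symm).pow_left n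
  have hm0 : (m : ℚ) ≠ 0 := by exact_mod_cast NeZero.ne m
  set u : (ZMod m)ˣ := ZMod.unitOfCoprime (p ^ n) hcop with hu
  have huval : (u : ZMod m) = (p : ZMod m) ^ n := by rw [hu, ZMod.coe_unitOfCoprime, Nat.cast_pow]
  set w : (ZMod m)ˣ := ZMod.unitOfCoprime p hmp.symm with hw
  have hwval : (w : ZMod m) = (p : ZMod m) := by rw [hw, ZMod.coe_unitOfCoprime]
  -- left: reindex by `u = pⁿ` and evaluate the tame fraction
  have hL : ∑ b : ZMod m, χ b * ratMinusSymbol f ((p : ℚ) * tameFraction p m n (a * (m : ZMod (p ^ n))) b) =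
      χ ((p : ZMod m) ^ n) * ∑ b : ZMod m, χ b *
        ratMinusSymbol f ((p : ℚ) * ((a.val : ℚ) / (p : ℚ) ^ n) + (p : ℚ) * (b.val : ℚ) / m) := by
    rw [← sum_mul_unit_eq_minus u, Finset.mul_sum]
    refine Finset.sum_congr rfl fun b _ ↦ ?_
    rw [huval, tameFraction_mul_eq hmp n a b, map_mul, mul_add, mul_div_assoc']
    ring
  -- right: reindex by `w = p` and remove the carry
  have hR : ∑ b : ZMod m, χ b * ratMinusSymbol f ((p : ℚ) * ((a.val : ℚ) / (p : ℚ) ^ n) + (b.val : ℚ) / m) =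
      χ (p : ZMod m) * ∑ b : ZMod m, χ b *
        ratMinusSymbol f ((p : ℚ) * ((a.val : ℚ) / (p : ℚ) ^ n) + (p : ℚ) * (b.val : ℚ) / m) := by
    rw [← sum_mul_unit_eq_minus w, Finset.mul_sum]
    refine Finset.sum_congr rfl fun b _ ↦ ?_
    rw [hwval, map_mul]
    -- the carry: `(b p).val = p b.val - m k`
    have hk : ((m : ℤ) : ℤ) ∣ (p : ℤ) * b.val - ((b * (p : ZMod m)).val : ℤ) := by
      rw [← ZMod.intCast_zmod_eq_zero_iff_dvd]
      push_cast
      rw [ZMod.natCast_zmod_val, ZMod.natCast_zmod_val]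
      ring
    obtain ⟨k, hk⟩ := hk
    have e : (p : ℚ) * ((a.val : ℚ) / (p : ℚ) ^ n) + ((b * (p : ZMod m)).val : ℚ) / m =
        (p : ℚ) * ((a.val : ℚ) / (p : ℚ) ^ n) + (p : ℚ) * (b.val : ℚ) / m + ((-k : ℤ) : ℚ) := by
      have hk' : (((b * (p : ZMod m)).val : ℕ) : ℚ) = (p : ℚ) * b.val - (m : ℚ) * k := by
        have := congrArg (Int.cast : ℤ → ℚ) hk
        push_cast at this
        linarith
      rw [hk']
      push_cast
      field_simp
      ring
    rw [e, ratMinusSymbol_add_intCast f]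
    ring
  rw [hL, hR]
  ring

omit [NeZero N'] in
/-- **Birch's lemma at the level of the measures for an ODD twisting relation (the algebraic step).** Let `χ` be a
`ℚ`-valued multiplicative character mod `m`, `(m, p) = 1`, with `χ(p)² = 1`, `c ∈ ℚ`, and assume the symbol-level twisting
relation ON THE MINUS SYMBOL `hB : ∀ x, [x]⁺_g = c · Σ_{b mod m} χ(b) [x + b/m]⁻_f` (the shape of
`exists_rat_forall_ratPlusSymbol_charTwist_eq_of_odd` for an odd quadratic `χ`). Then for every `n` and `a mod pⁿ`:
`μ_{g, χ(p)α}(a + pⁿℤ_p) = c · Σ_{b mod m} χ(b) · μ⁻_{f,α,m}((a·m + pⁿℤ_p) × {b})`, i.e.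
`msdMeasure g (χ(p)·α) n a = c · Σ_b χ(b) · msdMeasureTameMinus f m α n (a·m) b` — word for word the proof of
`msdMeasure_twist_eq_sum_msdMeasureTame`. [cite: MazurTateTeitelbaum1986Invent, §I.8–I.10 (pp. 10–13)] [cite: Matsuno2000, §2 (p. 84)] -/
theorem msdMeasure_twist_eq_sum_msdMeasureTameMinus (hmp : m.Coprime p) (χ : MulChar (ZMod m) ℚ)
    (hχp : χ (p : ZMod m) ^ 2 = 1) {c : ℚ}
    (hB : ∀ x : ℚ, ratPlusSymbol g x = c * ∑ b : ZMod m, χ b * ratMinusSymbol f (x + (b.val : ℚ) / m))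
    (α : ℚ_[p]) : ∀ (n : ℕ) (a : ZMod (p ^ n)),
    msdMeasure g (((χ (p : ZMod m) : ℚ) : ℚ_[p]) * α) n a =
      (c : ℚ_[p]) * ∑ b : ZMod m, ((χ b : ℚ) : ℚ_[p]) * msdMeasureTameMinus f m α n (a * (m : ZMod (p ^ n))) b := by
  have hp : p.Prime := Fact.out
  -- `χ(p)⁻¹ = χ(p)` and `χ(pⁿ) = χ(p)ⁿ`
  have hχp1 : χ (p : ZMod m) ≠ 0 := by
    intro h; rw [h] at hχp; norm_num at hχp
  have hinv : (((χ (p : ZMod m) : ℚ) : ℚ_[p]))⁻¹ = ((χ (p : ZMod m) : ℚ) : ℚ_[p]) := by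
    have h2 : ((χ (p : ZMod m) : ℚ) : ℚ_[p]) * ((χ (p : ZMod m) : ℚ) : ℚ_[p]) = 1 := by
      rw [← Rat.cast_mul, ← pow_two, hχp, Rat.cast_one]
    exact inv_eq_of_mul_eq_one_right h2
  have hpow : ∀ n : ℕ, χ ((p : ZMod m) ^ n) = χ (p : ZMod m) ^ n := fun n ↦ map_pow χ _ n
  -- the two Birch sums, cast to `ℚ_p`
  have key1 : ∀ (n : ℕ) (a : ZMod (p ^ n)),
      (c : ℚ_[p]) * ∑ b : ZMod m, ((χ b : ℚ) : ℚ_[p]) *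
        (ratMinusSymbol f (tameFraction p m n (a * (m : ZMod (p ^ n))) b) : ℚ_[p]) =
        ((χ (p : ZMod m) : ℚ) : ℚ_[p]) ^ n * (ratPlusSymbol g ((a.val : ℚ) / (p : ℚ) ^ n) : ℚ_[p]) := by
    intro n a
    have h := sum_mul_ratMinusSymbol_tameFraction_eq f hmp χ n a
    rw [hpow] at h
    have h' := congrArg (fun q : ℚ ↦ ((c * q : ℚ) : ℚ_[p])) h
    rw [hB ((a.val : ℚ) / (p : ℚ) ^ n)]
    push_cast at h' ⊢
    rw [h']
    ring
  have key2 : ∀ (n : ℕ) (a : ZMod (p ^ n)),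
      (c : ℚ_[p]) * ∑ b : ZMod m, ((χ b : ℚ) : ℚ_[p]) *
        (ratMinusSymbol f ((p : ℚ) * tameFraction p m n (a * (m : ZMod (p ^ n))) b) : ℚ_[p]) =
        ((χ (p : ZMod m) : ℚ) : ℚ_[p]) ^ (n + 1) *
          (ratPlusSymbol g ((p : ℚ) * ((a.val : ℚ) / (p : ℚ) ^ n)) : ℚ_[p]) := by
    intro n a
    have h := sum_mul_ratMinusSymbol_prime_mul_tameFraction_eq f hmp χ n a
    rw [hpow] at h
    -- multiply by `χ(p)` and use `χ(p)² = 1`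
    have h1 : ∑ b : ZMod m, χ b * ratMinusSymbol f ((p : ℚ) * tameFraction p m n (a * (m : ZMod (p ^ n))) b) =
        χ (p : ZMod m) ^ (n + 1) *
          ∑ b : ZMod m, χ b * ratMinusSymbol f ((p : ℚ) * ((a.val : ℚ) / (p : ℚ) ^ n) + (b.val : ℚ) / m) := by
      have := congrArg (fun q ↦ χ (p : ZMod m) * q) h
      rw [← mul_assoc, ← pow_two, hχp, one_mul] at this
      rw [this]
      ring
    have h' := congrArg (fun q : ℚ ↦ ((c * q : ℚ) : ℚ_[p])) h1
    rw [hB ((p : ℚ) * ((a.val : ℚ) / (p : ℚ) ^ n))]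
    push_cast at h' ⊢
    rw [h']
    ring
  intro n a
  -- expand the right-hand side
  have hRHS : (c : ℚ_[p]) * ∑ b : ZMod m, ((χ b : ℚ) : ℚ_[p]) * msdMeasureTameMinus f m α n (a * (m : ZMod (p ^ n))) b =
      α⁻¹ ^ n * ((c : ℚ_[p]) * ∑ b : ZMod m, ((χ b : ℚ) : ℚ_[p]) *
        (ratMinusSymbol f (tameFraction p m n (a * (m : ZMod (p ^ n))) b) : ℚ_[p])) -
      α⁻¹ ^ (n + 1) * ((c : ℚ_[p]) * ∑ b : ZMod m, ((χ b : ℚ) : ℚ_[p]) *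
        (ratMinusSymbol f ((p : ℚ) * tameFraction p m n (a * (m : ZMod (p ^ n))) b) : ℚ_[p])) := by
    simp only [msdMeasureTameMinus, Finset.mul_sum, ← Finset.sum_sub_distrib]
    refine Finset.sum_congr rfl fun b _ ↦ ?_
    ring
  rw [hRHS, key1, key2]
  cases n with
  | zero =>
    have ha : a.val = 0 := by
      have h1 : a.val < p ^ 0 := ZMod.val_lt a
      have h2 : p ^ 0 = 1 := rfl
      omega
    simp only [msdMeasure, ha, Nat.cast_zero, zero_div, mul_zero, pow_zero, one_mul, zero_add, pow_one, mul_inv, hinv]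
    ring
  | succ n =>
    have hp0 : (p : ℚ) ≠ 0 := by exact_mod_cast hp.ne_zero
    have hx : (p : ℚ) * ((a.val : ℚ) / (p : ℚ) ^ (n + 1)) = (a.val : ℚ) / (p : ℚ) ^ n := by
      rw [pow_succ (p : ℚ) n]; field_simp
    simp only [msdMeasure, hx, mul_inv, inv_pow, hinv]
    ring

end Birch

end Literature.NumberTheory.EllipticCurves

end
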